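import Summits.FinalStateConjecture.FinalStateConjecture.Theorems.ClusterCompletenessOmegaLimitMultiKerrDefs
import Summits.FinalStateConjecture.FinalStateConjecture.Theorems.ZeroEnergyKerrOrBombStationaryLimitReductionIsometryTransport
import Literature.Geometry.Lorentzian.MGHDUniqueness
import HarnessLib

/-!
# Crux `ClusterCompleteness.OmegaLimitMultiKerr` (stmt-FinalStateConjecture-14664), line `Sketch` —
# recurrence is a property of the isometry class of a development; the single-development form
# of the crux

Support lemmas of the line lead (gen 1), over the landed vocabulary `Recurs k` / `OmegaAt k` of
`ClusterCompletenessOmegaLimitMultiKerrDefs`.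

* `recurs_of_isIsometricTo` — **the recur interface is transported along isometries of
  developments**: if `𝒟₁ ≅ 𝒟₂` as developments of the same datum (a time-orientation preserving
  isometric diffeomorphism `ψ` with `ψ ∘ ι₁ = ι₂`) and `𝒟₁` recurs at order `k`, so does `𝒟₂` — with
  the charts `ψ ∘ Ψᵢ`, `ψ ∘ Ψ₀`, the same labels, motions, radii and flat domain, and the SAME
  deviation functions; the self-determined exterior, the certified regions and their causal pasts
  are carried by `ψ` (`J⁺`, `I⁻`, `J⁻` commute with `ψ` because both `ψ` and `ψ⁻¹` are
  time-orientation preserving isometries). All transport bookkeeping is the tree's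
  (`Theorems.OneLockedExplosion.isLateChart_comp / deviationCk_comp / truncDeviationCk_comp /
  image_causalFuture_eq / image_chronologicalPast_eq`, `LorentzianMetric.image_causalPast_subset`);
  nothing is re-proved here.
* `omegaAt_of_generic_exists_recurs` — **THE SINGLE-DEVELOPMENT FORM OF THE CRUX**: since maximal
  vacuum Cauchy developments are unique up to isometry of developments (tree theorem
  `VacuumCauchyDevelopment.isIsometricTo_of_isMaximal'`, Choquet-Bruhat–Geroch 1969, Thm. 3), the
  crux at order `k` follows from "generically in the admissible class, SOME maximal development
  recurs at order `k`" — one development per datum, no `∀ MGHD`, no `¬ Settles` guard, no MGHD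
  existence fact. Conversely the crux gives "generically, some MGHD settles or recurs"
  (`generic_exists_settles_or_recurs_of_omegaAt`); at order `k ≤ 2`, where a settled MGHD recurs
  (`recurs_of_settles`, `…SettlesRecurs.lean`), the two statements are therefore equivalent.

Everything is proved; Mathlib + landed tree modules only (sibling `Theorems` module of route
`OneLockedExplosion` for the isometry-transport bookkeeping, import cone = Statement + Literature).
-/

-- every `Summit.FinalStateConjecture.FinalStateConjecture.…` name repeats the summit = sub-problem segment (D-0017 layout)
set_option linter.dupNamespace false

noncomputable section

open scoped Manifold ContDiff Topology ENNReal
open Set Filter TopologicalSpace Function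

namespace Summit.FinalStateConjecture.FinalStateConjecture.Theorems.ClusterCompleteness

open Literature.Geometry.Lorentzian
open Summit.FinalStateConjecture.FinalStateConjecture.Theorems.OneLockedExplosion
  (mdifferentiable_diffeomorph image_causalFuture_eq image_chronologicalPast_eq deviationCk_comp
    truncDeviationCk_comp isLateChart_comp)

/-! ### Recurrence is transported along isometries of developments -/

section PerDevelopment

variable {X : Type} [TopologicalSpace X] [ChartedSpace E3 X] [IsManifold (𝓡 3) ∞ X]
  [ConnectedSpace X] {D : InitialDataSet (𝓡 3) X}

/-- **The recur interface is a property of the isometry class of a development.** If the vacuum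
Cauchy developments `𝒟₁`, `𝒟₂` of the same datum are isometric as developments
(`CauchyDevelopment.IsIsometricTo`: a time-orientation preserving isometric diffeomorphism `ψ` with
`ψ ∘ ι₁ = ι₂`) and `𝒟₁` recurs at order `k`, then `𝒟₂` recurs at order `k`: take the charts
`ψ ∘ Ψᵢ`, `ψ ∘ Ψ₀` with the same labels, motions, excision and exhaustion radii and flat domain; the
deviations are literally the same functions (`deviationCk_comp`, `truncDeviationCk_comp`), the region becomes
`ψ(O)`, which is the exterior region of the transported charted set because `ψ` commutes with
`J⁺`, `I⁻` (both `ψ` and `ψ⁻¹` are time-orientation preserving isometries and `ψ(ι₁ X) = ι₂ X`),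
exhaustion is transported by `ψ(J⁻(S)) ⊆ J⁻(ψ(S))`, and separation by injectivity of `ψ`.
[folklore] -/
theorem recurs_of_isIsometricTo {𝒟₁ 𝒟₂ : VacuumCauchyDevelopment D}
    (h : 𝒟₁.toCauchyDevelopment.IsIsometricTo 𝒟₂.toCauchyDevelopment) {k : ℕ}
    (hr : Recurs k 𝒟₁) : Recurs k 𝒟₂ := by
  obtain ⟨ψ, hiso, hτ, hι⟩ := h
  obtain ⟨O, N, M, a, mo, τ₀, Ψ, ρ, R, U₀, Ψ₀, h₁, h₂, h₃, h₄, h₅, h₆, h₇, h₈, h₉, h₁₀, h₁₁⟩ := hr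
  have hψd : MDifferentiable (𝓡 4) (𝓡 4) ψ := mdifferentiable_diffeomorph ψ
  have hinj : Injective ψ := ψ.injective
  have hrange : (ψ : 𝒟₁.carrier → 𝒟₂.carrier) '' range 𝒟₁.embed = range 𝒟₂.embed := by
    rw [← range_comp]
    exact congrArg range hι
  -- the transported charted late region is `ψ` of the original one
  have hC : ((⋃ i, (ψ ∘ Ψ i) '' (boostedKerrBackground (mo i).1 (mo i).2 (M i) (a i)).lateRegion τ₀) ∪
      (ψ ∘ Ψ₀) '' (Minkowski.backgroundOn U₀).lateRegion τ₀) =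
        ψ '' ((⋃ i, Ψ i '' (boostedKerrBackground (mo i).1 (mo i).2 (M i) (a i)).lateRegion τ₀) ∪
          Ψ₀ '' (Minkowski.backgroundOn U₀).lateRegion τ₀) := by
    simp only [image_union, image_iUnion, image_comp]
  refine ⟨ψ '' O, N, M, a, mo, τ₀, fun i ↦ ψ ∘ Ψ i, ρ, R, U₀, ψ ∘ Ψ₀, h₁,
    fun i ↦ isLateChart_comp ψ _ (h₂ i), isLateChart_comp ψ _ h₃, h₄, h₅, h₆, fun R' ↦ ?_, ?_,
    fun τ₁ hτ₁ ↦ ?_, fun τ hτ' ↦ ?_, fun R' ε hε ↦ ?_⟩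
  · -- separation is preserved by the injective `ψ`
    obtain ⟨τ₁, hτ₁⟩ := h₇ R'
    refine ⟨τ₁, fun i j hij ↦ ?_⟩
    have hd := hτ₁ hij
    simp only [Function.onFun, image_comp] at hd ⊢
    exact (disjoint_image_iff hinj).mpr hd
  · -- `ψ '' O` is the exterior region of the transported charted late region
    beta_reduce
    rw [hC, h₈]
    change ψ '' (𝒟₁.metric.causalFuture 𝒟₁.timeOrientation (range 𝒟₁.embed) ∩
        𝒟₁.metric.chronologicalPast 𝒟₁.timeOrientation _) =
      𝒟₂.metric.causalFuture 𝒟₂.timeOrientation (range 𝒟₂.embed) ∩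
        𝒟₂.metric.chronologicalPast 𝒟₂.timeOrientation _
    rw [image_inter hinj, image_causalFuture_eq ψ hiso hτ, hrange,
      image_chronologicalPast_eq ψ hiso hτ]
  · -- exhaustion, transported by `ψ(J⁻(S)) ⊆ J⁻(ψ(S))`
    intro p hp
    beta_reduce at hp
    have hcert : (ψ ∘ Ψ₀) '' (Minkowski.backgroundOn U₀).lateRegion τ₁ ∪
        ⋃ i, (ψ ∘ Ψ i) '' {x | τ₁ < (boostedKerrBackground (mo i).1 (mo i).2 (M i) (a i)).time x.1 ∧
          (boostedKerrBackground (mo i).1 (mo i).2 (M i) (a i)).radius x.1 ≤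
            R i ((boostedKerrBackground (mo i).1 (mo i).2 (M i) (a i)).time x.1)} =
        ψ '' (Ψ₀ '' (Minkowski.backgroundOn U₀).lateRegion τ₁ ∪
          ⋃ i, Ψ i '' {x | τ₁ < (boostedKerrBackground (mo i).1 (mo i).2 (M i) (a i)).time x.1 ∧
            (boostedKerrBackground (mo i).1 (mo i).2 (M i) (a i)).radius x.1 ≤
              R i ((boostedKerrBackground (mo i).1 (mo i).2 (M i) (a i)).time x.1)}) := by
      simp only [image_union, image_iUnion, image_comp]
    have hslab : (ψ ∘ Ψ₀) '' (Minkowski.backgroundOn U₀).timeSlab τ₁ ∪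
        ⋃ i, (ψ ∘ Ψ i) '' (boostedKerrBackground (mo i).1 (mo i).2 (M i) (a i)).truncTimeSlab
          (R i τ₁) τ₁ =
        ψ '' (Ψ₀ '' (Minkowski.backgroundOn U₀).timeSlab τ₁ ∪
          ⋃ i, Ψ i '' (boostedKerrBackground (mo i).1 (mo i).2 (M i) (a i)).truncTimeSlab
            (R i τ₁) τ₁) := by
      simp only [image_union, image_iUnion, image_comp]
    rw [hcert] at hp
    obtain ⟨⟨q, hqO, rfl⟩, hp2⟩ := hp
    have hq := h₉ τ₁ hτ₁ ⟨hqO, fun hq ↦ hp2 (mem_image_of_mem ψ hq)⟩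
    have h := LorentzianMetric.image_causalPast_subset hψd hτ hiso _ (mem_image_of_mem ψ hq)
    beta_reduce
    rw [hslab]
    exact h
  · -- the uniform `C⁰` anchor: same deviation functions
    exact ⟨(deviationCk_comp ψ _ h₃.contMDiff hiso 0 τ).trans_le (h₁₀ τ hτ').1, fun i ↦
      (truncDeviationCk_comp ψ _ (h₂ i).contMDiff hiso 0 (R i τ) τ).trans_le ((h₁₀ τ hτ').2 i)⟩
  · -- recurrence: same deviation functions
    exact (h₁₁ R' ε hε).mono fun τ hτ'' ↦
      ⟨(deviationCk_comp ψ _ h₃.contMDiff hiso k τ).trans_le hτ''.1, fun i ↦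
        (truncDeviationCk_comp ψ _ (h₂ i).contMDiff hiso k R' τ).trans_le (hτ''.2 i)⟩

end PerDevelopment

/-! ### The single-development form of the crux -/

section Genericity

variable {E : Type*} [NormedAddCommGroup E] [NormedSpace ℝ E] {H : Type*} [TopologicalSpace H]
  {I : ModelWithCorners ℝ E H} {X : Type*} [TopologicalSpace X] [ChartedSpace H X]
  [IsManifold I ((⊤ : ℕ∞) : WithTop ℕ∞) X]

/-- Christodoulou's curve-genericity is monotone in the property (local copy of
`Theorems.CaptureSuffices.Negative.isChristodoulouGeneric_mono`, keeping this module's import cone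
inside the route). [folklore] -/
private theorem isChristodoulouGeneric_mono'' {𝓓 : Set (InitialDataSet I X)}
    {P Q : InitialDataSet I X → Prop} (hPQ : ∀ d ∈ 𝓓, P d → Q d) {m : ℕ}
    (h : InitialDataSet.IsChristodoulouGeneric 𝓓 P m) :
    InitialDataSet.IsChristodoulouGeneric 𝓓 Q m := by
  intro d hd
  obtain ⟨F, hF, h0, hinj, hadm, hexc⟩ := h d ⟨hd.1, fun hP ↦ hd.2 (hPQ d hd.1 hP)⟩
  exact ⟨F, hF, h0, hinj, hadm,
    fun c hc hmem ↦ hexc c hc ⟨hmem.1, fun hP ↦ hmem.2 (hPQ _ hmem.1 hP)⟩⟩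

end Genericity

/-- **The single-development form of the crux.** If, for every connected Hausdorff second-countable
`3`-manifold, Christodoulou-generically in the admissible class SOME maximal vacuum Cauchy
development recurs at order `k`, then `OmegaAt k` (the crux `OmegaLimitMultiKerr` at order `k`)
holds: maximal developments of a datum are pairwise isometric as developments
(`VacuumCauchyDevelopment.isIsometricTo_of_isMaximal'`, Choquet-Bruhat–Geroch 1969, Thm. 3,
uniqueness clause — a tree theorem) and recurrence is transported along such isometries
(`recurs_of_isIsometricTo`), so EVERY maximal development recurs, settled or not. A line therefore
proves recurrence for one maximal development per generic datum; neither the `¬ Settles` guard nor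
the MGHD-existence fact is needed in this direction. [folklore] -/
theorem omegaAt_of_generic_exists_recurs : ∀ k : ℕ,
    (∀ (X : Type) [TopologicalSpace X] [ChartedSpace E3 X] [IsManifold (𝓡 3) ∞ X]
      [T2Space X] [SecondCountableTopology X] [ConnectedSpace X],
      InitialDataSet.IsChristodoulouGeneric (admissibleVacuumData X)
        (fun D ↦ ∃ 𝒟 : VacuumCauchyDevelopment D, 𝒟.IsMaximal ∧ Recurs k 𝒟) 1) →
    OmegaAt k := by
  intro k h X _ _ _ _ _ _
  refine isChristodoulouGeneric_mono'' (fun D _ hP ↦ ?_) (h X)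
  obtain ⟨𝒟₀, h𝒟₀, hr⟩ := hP
  exact ⟨⟨𝒟₀, h𝒟₀⟩, fun 𝒟 h𝒟 _ ↦
    recurs_of_isIsometricTo (VacuumCauchyDevelopment.isIsometricTo_of_isMaximal' h𝒟₀ h𝒟) hr⟩

/-- Conversely, the crux at order `k` gives: generically, some maximal development settles or
recurs at order `k` (its own MGHD-existence conjunct supplies the development). [folklore] -/
theorem generic_exists_settles_or_recurs_of_omegaAt {k : ℕ} (h : OmegaAt k)
    (X : Type) [TopologicalSpace X] [ChartedSpace E3 X] [IsManifold (𝓡 3) ∞ X] [T2Space X]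
    [SecondCountableTopology X] [ConnectedSpace X] :
    InitialDataSet.IsChristodoulouGeneric (admissibleVacuumData X)
      (fun D ↦ ∃ 𝒟 : VacuumCauchyDevelopment D, 𝒟.IsMaximal ∧ (Settles 𝒟 ∨ Recurs k 𝒟)) 1 := by
  refine isChristodoulouGeneric_mono'' (fun D _ hP ↦ ?_) (h X)
  obtain ⟨⟨𝒟₀, h𝒟₀⟩, hall⟩ := hP
  by_cases hS : Settles 𝒟₀
  · exact ⟨𝒟₀, h𝒟₀, Or.inl hS⟩
  · exact ⟨𝒟₀, h𝒟₀, Or.inr (hall 𝒟₀ h𝒟₀ hS)⟩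

end Summit.FinalStateConjecture.FinalStateConjecture.Theorems.ClusterCompleteness

end
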